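import Literature.Barriers.CriticalPhenomena.SubexponentialGrowthZdProofs
import Literature.Probability.Percolation.SharpnessQuasiTransitiveProofs
import HarnessLib

/-!
# Hutchcroft 2016, Thm. 2 (`κ_{p_c}(n) ≤ gr(G)^{-n}`), PROVED: discharge of Thm. 6 and assembly

(Proofs for `SubexponentialGrowthZd.lean`, continued.)

Barrier catalogue `Literature/Barriers/CriticalPhenomena/`, second proof file of
`SubexponentialGrowthZd.lean`. The sibling `SubexponentialGrowthZdProofs.lean` reduces the named
fact `Hutchcroft2016_connectivityDecay` (T. Hutchcroft, *C. R. Math. Acad. Sci. Paris* 354 (2016)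
944–947, Thm. 2) to Hutchcroft's Thm. 6 — finite expected cluster size below `p_c` on
quasi-transitive graphs (Aizenman–Barsky 1987; Antunović–Veselić 2008, Thm. 2), vendored there as
the named fact `AntunovicVeselic2008_finiteSusceptibility` — by
`Hutchcroft2016_connectivityDecay_of_finiteSusceptibility`. Here:

* `AntunovicVeselic2008_finiteSusceptibility_holds` — **Thm. 6 DISCHARGED** by the
  Duminil-Copin–Tassion proof of sharpness ported from `ℤ^d` (`SharpnessDCTProofs.lean`) to
  connected, locally finite, quasi-transitive graphs in
  `Literature/Probability/Percolation/SharpnessQuasiTransitive{,MeanField,Susceptibility,Proofs}.lean`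
  (`Literature.Probability.Percolation.DCTQ.summable_real_openConn_of_lt_criticalProb`: Lemma 2.1
  and the mean-field bound at each orbit representative `u` give finite sets `S_u ∋ u` with
  `φ_p(u, S_u) < 1` for `p < p_c`; transported along `Aut(G)` they form a uniform family, and the
  exploration inequality on truncated susceptibilities with `Λ ↑ V` gives `Σ_x τ_p(ρ, x) < ∞`);
* `Hutchcroft2016_connectivityDecay_holds` — **Thm. 2 PROVED**, unconditionally.

This file is a separate module only because `SubexponentialGrowthZdProofs.lean` declares the named
fact (a `def`), so that appending there is not a pure-proof change; nothing else is deliberately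
left out.

## References

* T. Hutchcroft, C. R. Math. Acad. Sci. Paris 354 (2016) 944–947 (arXiv:1605.05301), Thm. 2,
  Thm. 6 and §2 (proof of Thm. 2). [Hutchcroft2016]
* T. Antunović, I. Veselić, J. Stat. Phys. 130 (2008) 983–1009, Thm. 2. [AntunovicVeselic2007]
* H. Duminil-Copin, V. Tassion, Comm. Math. Phys. 343 (2016) 725–745, Thm. 1.1.
  [DuminilCopinTassionCMP2016]
-/

noncomputable section

namespace Literature.Barriers.CriticalPhenomena

open Literature.Probability.Percolation

/-- **Hutchcroft 2016, Thm. 6 / Antunović–Veselić 2008, Thm. 2, DISCHARGED**: finite expected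
cluster size below `p_c` for bond percolation on a connected, locally finite, quasi-transitive
graph — the named fact `AntunovicVeselic2008_finiteSusceptibility` of
`SubexponentialGrowthZdProofs.lean` ("Let `G` be a quasi-transitive graph, and let `ρ` be a fixed
vertex of `G`. Then the expected cluster size is finite for every `p < p_c`. That is,
`Σ_x τ_p(ρ, x) < ∞` for every `p < p_c`"), by the Duminil-Copin–Tassion proof ported to
quasi-transitive graphs
(`Literature.Probability.Percolation.DCTQ.summable_real_openConn_of_lt_criticalProb`).
[cite: Hutchcroft2016, Thm. 6] [cite: AntunovicVeselic2007, Thm. 2]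
[cite: DuminilCopinTassionCMP2016, Thm. 1.1] -/
theorem AntunovicVeselic2008_finiteSusceptibility_holds :
    AntunovicVeselic2008_finiteSusceptibility := by
  intro V G _ hconn hqt ρ p hp
  obtain ⟨V₀, hV₀⟩ := hqt
  exact DCTQ.summable_real_openConn_of_lt_criticalProb G hconn hV₀ ρ p hp

/-- **Hutchcroft 2016, Thm. 2, PROVED** ("Let `G` be a quasi-transitive graph with exponential
growth. Then `κ_{p_c}(n) := inf{τ_{p_c}(x,y) : x, y ∈ V, d(x,y) ≤ n} ≤ gr(G)^{-n}` for all
`n ≥ 1`"): the named fact `Hutchcroft2016_connectivityDecay` of `SubexponentialGrowthZd.lean`,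
for connected, locally finite, quasi-transitive graphs of exponential growth, with `p_c` and `gr`
read at the vertex `x`. Assembled exactly as printed in §2: Lemma 4 (`kappa_mul_le_kappa_add`,
Harris), Thm. 6 (`AntunovicVeselic2008_finiteSusceptibility_holds`), the bound
`κ_p(n)|B(ρ, n)| ≤ Σ_x τ_p(ρ, x)` with the Fekete step
(`kappa_le_growthRate_rpow_neg_of_summable`) for `p < p_c`, and Lemma 5
(`kappa_criticalProb_le`, left continuity at `p_c`) — i.e.
`Hutchcroft2016_connectivityDecay_of_finiteSusceptibility` applied to the discharged Thm. 6.
[cite: Hutchcroft2016, Thm. 2 and §2 (proof)] -/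
theorem Hutchcroft2016_connectivityDecay_holds : Hutchcroft2016_connectivityDecay :=
  Hutchcroft2016_connectivityDecay_of_finiteSusceptibility
    AntunovicVeselic2008_finiteSusceptibility_holds

end Literature.Barriers.CriticalPhenomena

end
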